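import Summits.NavierStokesRegularity.NavierStokesRegularity.Theorems.TypeIQuarterGateScarEnvelopeTypeIForcedTsaiWitnessW5T0Sound
import Summits.NavierStokesRegularity.NavierStokesRegularity.Theorems.TypeIQuarterGateScarEnvelopeTypeIForcedTsaiWitnessW5T0c

/-!
# Arm-B lane X: witness table `W5T0c` (the `d = 10` row) as a `ForcedTsaiModulusLE` theorem

Cell ns-wall-extremal, PREREG-WALL-1 A1 §B2(d), lane X (producer ns-wall-eng-5; format/checker/soundness by the cert hand
ns-crc-p2). `witnessTableW5T0c` = one row, axisymmetric-with-swirl polynomial × Gaussian class, `deg p ≤ 10`, `s = 7/10`, level 16: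
certified ratio 40.07 — the best row of lane X tranche 0. Composition with `WitnessRow.sound` via `WitnessTable.sound`;
rounded corollary `ForcedTsaiModulusLE 16 642`.

HONEST FRAME: an UPPER bound on the forced-Tsai modulus of the steady backward-Leray operator in an explicit witness class
(«a near-profile this good exists»); never an exclusion; Navier–Stokes regularity is OPEN and not addressed here.
`--supports stmt-NavierStokesRegularity-23843 --as helper --computational`.
-/

set_option linter.dupNamespace false

namespace Summit.NavierStokesRegularity.NavierStokesRegularity.Cruxes.ScarEnvelopeTypeI.ForcedTsai

/-- Table `W5T0c`: its row is a certified forced-Tsai witness. -/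
theorem witnessTableW5T0c_sound :
    ∀ r ∈ witnessTableW5T0c, ForcedTsaiModulusLE (r.M : ℝ) (r.δ : ℝ) :=
  WitnessTable.sound witnessTableW5T0c_check

/-- Rounded corollary (row `M = 16`, `δ = 10018521/15625 = 641.185…`): a smooth divergence-free field with
`‖curl U‖_{L²(B₁₀)} ≥ 16` and weighted vorticity residual `≤ 642` exists (certified ratio `≤ 40.2`). -/
theorem forcedTsaiModulusLE_16_642 : ForcedTsaiModulusLE 16 642 := by
  have hmem : witnessTableW5T0c[0] ∈ witnessTableW5T0c := List.getElem_mem (by decide)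
  have h := witnessTableW5T0c_sound _ hmem
  refine h.mono ?_ ?_
  · have : (witnessTableW5T0c[0]).M = 16 := by rfl
    rw [this]; push_cast; norm_num
  · have : (witnessTableW5T0c[0]).δ = 10018521 / 15625 := by rfl
    rw [this]; push_cast; norm_num

end Summit.NavierStokesRegularity.NavierStokesRegularity.Cruxes.ScarEnvelopeTypeI.ForcedTsai
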